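import Literature.Analysis.FluidPDE.CKNDuhamelTerms
import Literature.Analysis.FluidPDE.HeatKernelParabolicBounds
import Literature.Analysis.FluidPDE.SliceIdentities
import Literature.Analysis.UnboundedOperators.HeatDuhamelSliceRegularity
import HarnessLib

/-!
# Forward heat potentials: slice form and the weak-gradient identity for multiplier potentials

Analysis/FluidPDE support file (everything proved; no definitions, no named facts), written for
the proof of the named fact `Literature.Analysis.FluidPDE.jia_sverak_2014_local_higher_regularity`
(H. Jia, V. Šverák, Invent. Math. 196 (2014) = arXiv:1204.0529, §3 Thm 3.2 and the bootstrap
remark after its proof, p. 9). The localised Duhamel formula of the tree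
(`JiaSverak2014.duhamel_representation_datum`) is written with the space–time potentials
`W₊ ⊛ F` (`heatPotential`) and `Re σᵥ(D)W₊ ⊛ F` (`multiplierHeatPotential` with the gradient
symbol); the derivative bootstrap works slice by slice with the Duhamel integrals
`∫₀ᵗ e^{(t-s)Δ}F(s) ds` (`HeatDuhamelSliceRegularity.lean`). This file links the two:

* `heatPotential_eq_setIntegral_heatExtension` — **slice form**: for bounded measurable data
  supported in `[0, T] × ℝ³`, `W₊ ⊛ F (t, x) = ∫_{(0,t)} e^{(t-s)Δ}F(s, ·)(x) ds` at every point
  (Fubini);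
* `integral_test_mul_re_multiplierHeatPotential` — **the gradient-multiplier potential is the
  weak gradient of the heat potential**: `∫ θ Re σᵥ(D)W₊⊛F = -∫ ∂ᵥθ W₊⊛F` for all space–time test
  functions `θ` (the duality passages of `CKNDuhamelTerms.lean` and `∂ᵥ𝒰[θ] = 𝒰[∂ᵥθ]`), so that
  no pointwise identification of the multiplier potential with a derivative is ever needed;
* `ae_slice_weakGradient` — its time slices: for a.e. `t`, simultaneously for all test functions
  `ξ` on `ℝ³`, `∫ ξ Re σᵥ(D)W₊⊛F(t,·) = -∫ ∂ᵥξ W₊⊛F(t,·)` (`RepDeriv.ae_slice_identity_sum`).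

## References

* H. Jia, V. Šverák, Invent. Math. 196 (2014) = arXiv:1204.0529, §3 (p. 9). Bib key
  `JiaSverak2014`.
* P. G. Lemarié-Rieusset, *The Navier–Stokes Problem in the 21st Century* (2016), Prop. 4.3 and
  §13.9. Bib key `LemarieRieusset2016`.
-/

noncomputable section

open MeasureTheory Set Function Filter Metric TopologicalSpace
open _root_.Topology
open scoped ENNReal NNReal Convolution

namespace Literature.Analysis.FluidPDE

namespace HeatPotentialSlice

local notation "ℝ³" => EuclideanSpace ℝ (Fin 3)

/-! ## The heat potential of bounded data in slice (Duhamel) form -/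

/-- **Slice form of the forward heat potential**: for measurable bounded real data `F` on
`ℝ × ℝ³` supported in `[0, T] × ℝ³`, at every `(t, x)`,
`W₊ ⊛ F (t, x) = ∫_{(0,t)} e^{(t-s)Δ} F(s, ·) (x) ds` (Fubini: `W₊(t - s, x - y) = 1_{s<t} G_{t-s}(x - y)`
and `e^{τΔ}f(x) = ∫ G_τ(x - y) f(y) dy`). [folklore] -/
theorem heatPotential_eq_setIntegral_heatExtension {F : ℝ × ℝ³ → ℝ} (hFm : Measurable F)
    {N : ℝ} (hFN : ∀ z, |F z| ≤ N) {T : ℝ} (hFT : ∀ z, F z ≠ 0 → z.1 ∈ Icc (0 : ℝ) T)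
    (t : ℝ) (x : ℝ³) :
    heatPotential 1 F (t, x) =
      ∫ s in Ioo 0 t, UnboundedOperators.heatExtension (fun y => F (s, y)) (t - s) x := by
  have hN0 : 0 ≤ N := (abs_nonneg _).trans (hFN 0)
  -- the integrand on `ℝ × ℝ³` and its majorant
  set Φ : ℝ × ℝ³ → ℝ := fun w => heatKernelFwd 1 ((t, x) - w) * F w with hΦ
  have hKm : Measurable fun w : ℝ × ℝ³ => heatKernelFwd 1 ((t, x) - w) :=
    (measurable_heatKernelFwd 1).comp (measurable_const.sub measurable_id)
  have hΦm : Measurable Φ := hKm.mul hFm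
  have hK0 : ∀ w : ℝ × ℝ³, 0 ≤ heatKernelFwd 1 ((t, x) - w) := fun w => by
    unfold heatKernelFwd
    split_ifs with h
    · exact (UnboundedOperators.heatKernel_pos (by simpa using h) _).le
    · exact le_rfl
  -- slices of the kernel: for `s < t`, `y ↦ G_{t-s}(x - y)` has integral one; for `s ≥ t` it is `0`
  have hKslice : ∀ s, (fun y : ℝ³ => heatKernelFwd 1 ((t, x) - (s, y))) =
      fun y => if s < t then UnboundedOperators.heatKernel (t - s) (x - y) else 0 := by
    intro s; funext y
    simp only [heatKernelFwd, Prod.fst_sub, Prod.snd_sub, one_mul, sub_pos]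
  -- integrability on the product
  have hint : Integrable Φ (volume : Measure (ℝ × ℝ³)) := by
    rw [Measure.volume_eq_prod]
    refine (integrable_prod_iff hΦm.aestronglyMeasurable).2 ⟨?_, ?_⟩
    · refine Eventually.of_forall fun s => ?_
      simp only [hΦ]
      by_cases hs : s < t
      · have hτ : 0 < t - s := sub_pos.2 hs
        have hG : Integrable (fun y : ℝ³ => UnboundedOperators.heatKernel (t - s) (x - y)) :=
          (UnboundedOperators.integrable_heatKernel_holds hτ).comp_sub_left x
        refine (hG.mul_const N).mono' ((hKm.comp (measurable_const.prodMk measurable_id)).mul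
          (hFm.comp (measurable_const.prodMk measurable_id))).aestronglyMeasurable
          (Eventually.of_forall fun y => ?_)
        rw [norm_mul, Real.norm_eq_abs, Real.norm_eq_abs, abs_of_nonneg (hK0 _)]
        have e : heatKernelFwd 1 ((t, x) - (s, y)) = UnboundedOperators.heatKernel (t - s) (x - y) := by
          have := congrFun (hKslice s) y; simpa [hs] using this
        rw [e]
        exact mul_le_mul_of_nonneg_left (hFN _) (UnboundedOperators.heatKernel_pos hτ _).le
      · have : (fun y : ℝ³ => heatKernelFwd 1 ((t, x) - (s, y)) * F (s, y)) = fun _ => 0 := by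
          funext y
          have := congrFun (hKslice s) y
          simp only [hs, if_false] at this
          rw [this, zero_mul]
        simp only [this]
        exact integrable_zero _ _ _
    · -- `s ↦ ∫ |Φ(s, y)| dy ≤ N 1_{[0,T]}(s)`
      have hbound : ∀ s, ∫ y, ‖heatKernelFwd 1 ((t, x) - (s, y)) * F (s, y)‖ ≤
          (Icc (0 : ℝ) T).indicator (fun _ => N) s := by
        intro s
        by_cases hsT : s ∈ Icc (0 : ℝ) T
        · rw [indicator_of_mem hsT]
          by_cases hs : s < t
          · have hτ : 0 < t - s := sub_pos.2 hs
            have hG : Integrable (fun y : ℝ³ => UnboundedOperators.heatKernel (t - s) (x - y)) :=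
              (UnboundedOperators.integrable_heatKernel_holds hτ).comp_sub_left x
            calc ∫ y, ‖heatKernelFwd 1 ((t, x) - (s, y)) * F (s, y)‖
                ≤ ∫ y, UnboundedOperators.heatKernel (t - s) (x - y) * N := by
                  refine integral_mono_of_nonneg (Eventually.of_forall fun y => norm_nonneg _) (hG.mul_const N)
                    (Eventually.of_forall fun y => ?_)
                  have e : heatKernelFwd 1 ((t, x) - (s, y)) = UnboundedOperators.heatKernel (t - s) (x - y) := by
                    have := congrFun (hKslice s) y; simpa [hs] using this
                  beta_reduce
                  rw [norm_mul, Real.norm_eq_abs, Real.norm_eq_abs, e,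
                    abs_of_nonneg (UnboundedOperators.heatKernel_pos hτ _).le]
                  exact mul_le_mul_of_nonneg_left (hFN _) (UnboundedOperators.heatKernel_pos hτ _).le
              _ = N := by
                  rw [integral_mul_const]
                  have h1 : ∫ y, UnboundedOperators.heatKernel (t - s) (x - y) = 1 := by
                    have := integral_sub_left_eq_self (UnboundedOperators.heatKernel (E := ℝ³) (t - s)) x (μ := volume)
                    rw [this, UnboundedOperators.integral_heatKernel_eq_one_holds hτ]
                  rw [h1, one_mul]
          · have : (fun y : ℝ³ => ‖heatKernelFwd 1 ((t, x) - (s, y)) * F (s, y)‖) = fun _ => 0 := by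
              funext y
              have := congrFun (hKslice s) y
              simp only [hs, if_false] at this
              rw [this, zero_mul, norm_zero]
            rw [this, integral_zero]; exact hN0
        · rw [indicator_of_notMem hsT]
          have : (fun y : ℝ³ => ‖heatKernelFwd 1 ((t, x) - (s, y)) * F (s, y)‖) = fun _ => 0 := by
            funext y
            have hF0 : F (s, y) = 0 := by
              by_contra h; exact hsT (hFT _ h)
            rw [hF0, mul_zero, norm_zero]
          rw [this, integral_zero]
      refine ((integrableOn_const (measure_Icc_lt_top (μ := (volume : Measure ℝ)) (a := 0) (b := T)).ne).integrable_indicator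
        measurableSet_Icc).mono' ?_ (Eventually.of_forall fun s => ?_)
      · exact (hΦm.norm.stronglyMeasurable.integral_prod_right' (ν := (volume : Measure ℝ³))).aestronglyMeasurable
      · rw [Real.norm_of_nonneg (integral_nonneg fun y => norm_nonneg _)]
        exact hbound s
  -- Fubini
  rw [heatPotential, Measure.volume_eq_prod]
  have hsmul : (fun w : ℝ × ℝ³ => heatKernelFwd 1 ((t, x) - w) • F w) = Φ := by
    funext w; rw [smul_eq_mul]
  rw [hsmul, integral_prod Φ (by rwa [Measure.volume_eq_prod] at hint)]
  -- the inner integrals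
  have hinner : ∀ s, ∫ y, Φ (s, y) =
      (Ioo 0 t).indicator (fun s => UnboundedOperators.heatExtension (fun y => F (s, y)) (t - s) x) s +
        (if s = 0 ∧ s < t then UnboundedOperators.heatExtension (fun y => F (s, y)) (t - s) x else 0) := by
    intro s
    simp only [hΦ]
    by_cases hs : s < t
    · have e : ∀ y, heatKernelFwd 1 ((t, x) - (s, y)) = UnboundedOperators.heatKernel (t - s) (x - y) := fun y => by
        have := congrFun (hKslice s) y; simpa [hs] using this
      simp_rw [e]
      have hext : UnboundedOperators.heatExtension (fun y => F (s, y)) (t - s) x =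
          ∫ y, UnboundedOperators.heatKernel (t - s) (x - y) * F (s, y) := by
        rw [UnboundedOperators.heatExtension_eq_integral_sub]; simp only [smul_eq_mul]
      by_cases hs0 : 0 < s
      · rw [indicator_of_mem (show s ∈ Ioo 0 t from ⟨hs0, hs⟩), if_neg (fun h => hs0.ne' h.1), add_zero, hext]
      · by_cases hs00 : s = 0
        · rw [indicator_of_notMem (show s ∉ Ioo 0 t from fun h => hs0 h.1),
            if_pos (show s = 0 ∧ s < t from ⟨hs00, hs⟩), zero_add, hext]
        · -- `s < 0`: the data vanish
          have hF0 : ∀ y, F (s, y) = 0 := fun y => by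
            by_contra h
            have := (hFT _ h).1
            exact hs0 (lt_of_le_of_ne this (Ne.symm hs00))
          rw [indicator_of_notMem (show s ∉ Ioo 0 t from fun h => hs0 h.1), if_neg (fun h => hs00 h.1), add_zero]
          simp [hF0]
    · have e : ∀ y, heatKernelFwd 1 ((t, x) - (s, y)) = 0 := fun y => by
        have := congrFun (hKslice s) y; simpa [hs] using this
      simp_rw [e, zero_mul, integral_zero]
      rw [indicator_of_notMem (show s ∉ Ioo 0 t from fun h => hs h.2), if_neg (fun h => hs h.2), add_zero]
  simp_rw [hinner]
  -- the correction at `s = 0` is a.e. zero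
  have hae : (fun s => (Ioo 0 t).indicator (fun s => UnboundedOperators.heatExtension (fun y => F (s, y)) (t - s) x) s +
      (if s = 0 ∧ s < t then UnboundedOperators.heatExtension (fun y => F (s, y)) (t - s) x else 0)) =ᵐ[volume]
      fun s => (Ioo 0 t).indicator (fun s => UnboundedOperators.heatExtension (fun y => F (s, y)) (t - s) x) s := by
    have : ({0} : Set ℝ)ᶜ ∈ ae (volume : Measure ℝ) := compl_mem_ae_iff.2 (measure_singleton 0)
    filter_upwards [this] with s hs
    have hs0 : s ≠ 0 := by simpa using hs
    rw [if_neg (fun h => hs0 h.1), add_zero]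
  rw [integral_congr_ae hae, integral_indicator measurableSet_Ioo]

/-! ## The weak-gradient identity for gradient-multiplier potentials -/

/-- **Gradient-multiplier potentials are weak gradients of the heat potential**: for integrable
real data `F` supported in a time strip and every space–time test function `θ`,
`∫ θ · Re(σᵥ(D) W₊ ⊛ F) = -∫ ∂ᵥθ · (W₊ ⊛ F)`, i.e. `Re σᵥ(D)W₊ ⊛ F = ∂ᵥ(W₊ ⊛ F)` in the sense of
distributions (the tree's duality passages `∫ F ∂ᵥ𝒰[θ] = -∫ θ Re σᵥ(D)W₊⊛F`,
`∫ F 𝒰[∂ᵥθ] = ∫ ∂ᵥθ W₊⊛F`, and `∂ᵥ𝒰[θ] = 𝒰[∂ᵥθ]`). [folklore] -/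
theorem integral_test_mul_re_multiplierHeatPotential {F : ℝ × ℝ³ → ℝ} (hFi : Integrable F volume)
    {a b : ℝ} (hFsupp : ∀ᵐ z ∂(volume : Measure (ℝ × ℝ³)), F z ≠ 0 → z.1 ∈ Icc a b)
    {θ : ℝ → ℝ³ → ℝ} (hθ : IsSpaceTimeTestOn (⊤ : Opens (ℝ × ℝ³)) θ) (v : ℝ³) :
    ∫ w : ℝ × ℝ³, θ w.1 w.2 * (multiplierHeatPotential 1 (derivSymbol v) F w).re =
      -∫ w : ℝ × ℝ³, fderiv ℝ (θ w.1) w.2 v * heatPotential 1 F w := by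
  have h1 := pairing_fderiv_heatDuhamelBack_eq hθ one_pos hFi hFsupp v
  have h2 := pairing_heatDuhamelBack_eq (hθ.fderiv_apply_top v) one_pos hFi hFsupp
  have h12 : ∫ z : ℝ × ℝ³, F z * fderiv ℝ (heatDuhamelBack 1 θ z.1) z.2 v =
      ∫ z : ℝ × ℝ³, F z * heatDuhamelBack 1 (fun t y => fderiv ℝ (θ t) y v) z.1 z.2 := by
    refine integral_congr_ae (Eventually.of_forall fun z => ?_)
    beta_reduce
    rw [hθ.fderiv_heatDuhamelBack_apply one_pos z.1 z.2 v]
  rw [h12, h2] at h1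
  -- `h1 : ∫ ∂ᵥθ · W₊⊛F = ∫ θ · (-Re …)`
  have h3 : ∫ w : ℝ × ℝ³, θ w.1 w.2 * (-(multiplierHeatPotential 1 (derivSymbol v) F w).re) =
      -∫ w : ℝ × ℝ³, θ w.1 w.2 * (multiplierHeatPotential 1 (derivSymbol v) F w).re := by
    rw [← integral_neg]
    exact integral_congr_ae (Eventually.of_forall fun w => by ring)
  rw [h3] at h1
  linarith

/-! ## Time slices of the weak-gradient identity -/

/-- **Sliced weak-gradient identity**: if moreover the two potentials are locally integrable,
then for a.e. `t` in any time window, simultaneously for all test functions `ξ` on `ℝ³`,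
`∫ ξ · Re(σᵥ(D)W₊⊛F)(t, ·) = -∫ ∂ᵥξ · (W₊⊛F)(t, ·)` (the tree's slicing of space–time identities
of spatial order `≤ 2`, `RepDeriv.ae_slice_identity_sum`). [folklore] -/
theorem ae_slice_weakGradient {F : ℝ × ℝ³ → ℝ} (hFi : Integrable F volume)
    {a b : ℝ} (hFsupp : ∀ᵐ z ∂(volume : Measure (ℝ × ℝ³)), F z ≠ 0 → z.1 ∈ Icc a b)
    (v : ℝ³)
    (hP : LocallyIntegrable (fun w : ℝ × ℝ³ => (multiplierHeatPotential 1 (derivSymbol v) F w).re) volume)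
    (hQ : LocallyIntegrable (fun w : ℝ × ℝ³ => heatPotential 1 F w) volume) (a' b' : ℝ) :
    ∀ᵐ t ∂(volume.restrict (Ioo a' b')), ∀ ξ : ℝ³ → ℝ,
      FunctionSpaces.IsTestFunctionOn (⊤ : Opens ℝ³) ξ →
        ∫ x, ξ x * (multiplierHeatPotential 1 (derivSymbol v) F (t, x)).re =
          -∫ x, fderiv ℝ ξ x v * heatPotential 1 F (t, x) := by
  classical
  -- the two terms of the identity `∫ P ψ + ∫ Q ∂ᵥψ = 0`
  set h : Fin 2 → ℝ × ℝ³ → ℝ := fun m => if m = 0 then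
    (fun w => (multiplierHeatPotential 1 (derivSymbol v) F w).re) else fun w => heatPotential 1 F w with hh
  set ds : Fin 2 → List ℝ³ := fun m => if m = 0 then [] else [v] with hds
  have hhl : ∀ m, LocallyIntegrableOn (h m) (Ioo a' b' ×ˢ ((⊤ : Opens ℝ³) : Set ℝ³)) volume := by
    intro m
    fin_cases m
    · simpa [hh] using hP.locallyIntegrableOn _
    · simpa [hh] using hQ.locallyIntegrableOn _
  have hdsl : ∀ m, (ds m).length ≤ 2 := by
    intro m; fin_cases m <;> simp [hds]
  have hid : ∀ ψ : ℝ → ℝ³ → ℝ,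
      IsSpaceTimeTestOn (⟨Ioo a' b' ×ˢ ((⊤ : Opens ℝ³) : Set ℝ³), isOpen_Ioo.prod (⊤ : Opens ℝ³).isOpen⟩ :
        Opens (ℝ × ℝ³)) ψ →
        ∑ m, ∫ q : ℝ × ℝ³, h m q * RepDeriv.derivs (ds m) ψ q.1 q.2 = 0 := by
    intro ψ hψ
    have hψ' : IsSpaceTimeTestOn (⊤ : Opens (ℝ × ℝ³)) ψ :=
      ⟨hψ.contDiff, hψ.hasCompactSupport, fun _ _ => trivial⟩
    rw [Fin.sum_univ_two]
    simp only [hh, hds, if_true, if_false,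
      RepDeriv.derivs_nil, RepDeriv.derivs_singleton, show (1 : Fin 2) ≠ 0 from one_ne_zero]
    have key := integral_test_mul_re_multiplierHeatPotential hFi hFsupp hψ' v
    have e1 : ∫ q : ℝ × ℝ³, (multiplierHeatPotential 1 (derivSymbol v) F q).re * ψ q.1 q.2 =
        ∫ w : ℝ × ℝ³, ψ w.1 w.2 * (multiplierHeatPotential 1 (derivSymbol v) F w).re :=
      integral_congr_ae (Eventually.of_forall fun q => mul_comm _ _)
    have e2 : ∫ q : ℝ × ℝ³, heatPotential 1 F q * fderiv ℝ (ψ q.1) q.2 v =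
        ∫ w : ℝ × ℝ³, fderiv ℝ (ψ w.1) w.2 v * heatPotential 1 F w :=
      integral_congr_ae (Eventually.of_forall fun q => mul_comm _ _)
    rw [e1, e2, key]
    ring
  have hsl := RepDeriv.ae_slice_identity_sum hhl hdsl hid
  filter_upwards [hsl] with t ht ξ hξ
  have h0 := ht ξ hξ
  rw [Fin.sum_univ_two] at h0
  simp only [hh, hds, if_true, show (1 : Fin 2) ≠ 0 from one_ne_zero, if_false,
    RepDeriv.sderivs_nil, RepDeriv.sderivs_cons] at h0
  have e1 : ∫ x, (multiplierHeatPotential 1 (derivSymbol v) F (t, x)).re * ξ x =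
      ∫ x, ξ x * (multiplierHeatPotential 1 (derivSymbol v) F (t, x)).re :=
    integral_congr_ae (Eventually.of_forall fun x => mul_comm _ _)
  have e2 : ∫ x, heatPotential 1 F (t, x) * fderiv ℝ ξ x v = ∫ x, fderiv ℝ ξ x v * heatPotential 1 F (t, x) :=
    integral_congr_ae (Eventually.of_forall fun x => mul_comm _ _)
  rw [e1, e2] at h0
  linarith

/-! ## Local integrability of the potentials of integrable data -/

/-- The heat potential of integrable data with bounded time support is locally integrable.
[folklore] -/
theorem locallyIntegrable_heatPotential {F : ℝ × ℝ³ → ℝ} (hFi : Integrable F volume)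
    {a b : ℝ} (hFsupp : ∀ᵐ z ∂(volume : Measure (ℝ × ℝ³)), F z ≠ 0 → z.1 ∈ Icc a b) :
    LocallyIntegrable (fun w : ℝ × ℝ³ => heatPotential 1 F w) volume := by
  have hKh := (isSliceBoundKernel_backKernel_heatKernel (E := ℝ³)).timeScale one_pos
  have h : LocallyIntegrable (fun w => ((fun v => backKernel
      (fun a y => UnboundedOperators.heatKernel (E := ℝ³) (1 * a) y) (-v))
      ⋆[ContinuousLinearMap.lsmul ℝ ℝ, (volume : Measure (ℝ × ℝ³))] F) w) volume :=
    hKh.locallyIntegrable_convolution_reflect hFi hFsupp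
  simp only [convolution_reflect_backKernel_heatKernel] at h
  exact h

/-- The real part of the gradient-multiplier potential of integrable data with bounded time
support is locally integrable. [folklore] -/
theorem locallyIntegrable_re_multiplierHeatPotential {F : ℝ × ℝ³ → ℝ} (hFi : Integrable F volume)
    {a b : ℝ} (hFsupp : ∀ᵐ z ∂(volume : Measure (ℝ × ℝ³)), F z ≠ 0 → z.1 ∈ Icc a b) (v : ℝ³) :
    LocallyIntegrable (fun w : ℝ × ℝ³ => (multiplierHeatPotential 1 (derivSymbol v) F w).re) volume := by
  have hKg := (isSliceBoundKernel_backKernel_heatKernelGrad (E := ℝ³) v).timeScale one_pos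
  have h : LocallyIntegrable (fun w => ((fun q => backKernel (fun a y => heatKernelGrad v (1 * a) y) (-q))
      ⋆[ContinuousLinearMap.lsmul ℝ ℝ, (volume : Measure (ℝ × ℝ³))] F) w) volume :=
    hKg.locallyIntegrable_convolution_reflect hFi hFsupp
  simp only [convolution_reflect_backKernel_heatKernelGrad one_pos] at h
  exact h.neg.congr (Eventually.of_forall fun w => by simp)

/-- **Sliced weak-gradient identity, self-contained form** (local integrability supplied by the
previous lemmas). [folklore] -/
theorem ae_slice_weakGradient' {F : ℝ × ℝ³ → ℝ} (hFi : Integrable F volume)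
    {a b : ℝ} (hFsupp : ∀ᵐ z ∂(volume : Measure (ℝ × ℝ³)), F z ≠ 0 → z.1 ∈ Icc a b)
    (v : ℝ³) (a' b' : ℝ) :
    ∀ᵐ t ∂(volume.restrict (Ioo a' b')), ∀ ξ : ℝ³ → ℝ,
      FunctionSpaces.IsTestFunctionOn (⊤ : Opens ℝ³) ξ →
        ∫ x, ξ x * (multiplierHeatPotential 1 (derivSymbol v) F (t, x)).re =
          -∫ x, fderiv ℝ ξ x v * heatPotential 1 F (t, x) :=
  ae_slice_weakGradient hFi hFsupp v (locallyIntegrable_re_multiplierHeatPotential hFi hFsupp v)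
    (locallyIntegrable_heatPotential hFi hFsupp) a' b'

/-! ## Weak slice form of a representation by heat and gradient-multiplier potentials -/

/-- A locally integrable function times a space–time test function is integrable. [folklore] -/
theorem integrable_test_mul_of_locallyIntegrable {h : ℝ × ℝ³ → ℝ} (hh : LocallyIntegrable h volume)
    {ψ : ℝ → ℝ³ → ℝ} (hψ : IsSpaceTimeTestOn (⊤ : Opens (ℝ × ℝ³)) ψ) :
    Integrable (fun q : ℝ × ℝ³ => h q * ψ q.1 q.2) volume := by
  have h1 := hh.integrable_smul_left_of_hasCompactSupport hψ.contDiff.continuous hψ.hasCompactSupport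
  have e : (fun q : ℝ × ℝ³ => h q * ψ q.1 q.2) = fun q => uncurry ψ q • h q := by
    funext q; simp only [smul_eq_mul, uncurry]; ring
  rw [e]; exact h1

/-- **Weak slice form of a Duhamel-type representation.** Suppose that a.e. on the strip
`(0,T) × ℝ³` a locally integrable `L` is represented as
`L = A + Σᵢ(-Re σᵢ(D)W₊⊛D₂ᵢ) + Σᵢ(-Re σᵢ(D)W₊⊛D₄ᵢ) + (-Re σ_c(D)W₊⊛D₆)` with `A` locally integrable
and integrable data `D` supported in a time strip. Then for a.e. `t ∈ (0,T)`, simultaneously for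
all test functions `φ` on `ℝ³`,
`∫ L(t,·)φ = ∫ A(t,·)φ + Σᵢ ∫ (W₊⊛D₂ᵢ + W₊⊛D₄ᵢ)(t,·) ∂ᵢφ + ∫ W₊⊛D₆(t,·) ∂_cφ`
(the multiplier potentials are weak gradients of the heat potentials, and space–time identities
of spatial order `≤ 1` slice, `RepDeriv.ae_slice_identity_sum`). [folklore] -/
theorem ae_slice_weak_representation {T : ℝ} {L A : ℝ × ℝ³ → ℝ}
    (hL : LocallyIntegrable L volume) (hA : LocallyIntegrable A volume)
    {D2 D4 : Fin 3 → ℝ × ℝ³ → ℝ} {D6 : ℝ × ℝ³ → ℝ} {a b : ℝ}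
    (hD2i : ∀ i, Integrable (D2 i) volume) (hD2s : ∀ i, ∀ᵐ z ∂(volume : Measure (ℝ × ℝ³)), D2 i z ≠ 0 → z.1 ∈ Icc a b)
    (hD4i : ∀ i, Integrable (D4 i) volume) (hD4s : ∀ i, ∀ᵐ z ∂(volume : Measure (ℝ × ℝ³)), D4 i z ≠ 0 → z.1 ∈ Icc a b)
    (hD6i : Integrable D6 volume) (hD6s : ∀ᵐ z ∂(volume : Measure (ℝ × ℝ³)), D6 z ≠ 0 → z.1 ∈ Icc a b)
    (bv : Fin 3 → ℝ³) (c : ℝ³)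
    (hrep : ∀ᵐ z ∂(volume.restrict (Ioo 0 T ×ˢ (univ : Set ℝ³))),
      L z = A z + ∑ i, (-(multiplierHeatPotential 1 (derivSymbol (bv i)) (D2 i) z).re)
        + ∑ i, (-(multiplierHeatPotential 1 (derivSymbol (bv i)) (D4 i) z).re)
        + (-(multiplierHeatPotential 1 (derivSymbol c) D6 z).re)) :
    ∀ᵐ t ∂(volume.restrict (Ioo 0 T)), ∀ φ : ℝ³ → ℝ,
      FunctionSpaces.IsTestFunctionOn (⊤ : Opens ℝ³) φ →
        ∫ x, (L (t, x) - A (t, x)) * φ x =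
          (∑ i, ∫ x, (heatPotential 1 (D2 i) (t, x) + heatPotential 1 (D4 i) (t, x)) * fderiv ℝ φ x (bv i))
          + ∫ x, heatPotential 1 D6 (t, x) * fderiv ℝ φ x c := by
  classical
  -- local integrability of the potentials
  have lP2 : ∀ i, LocallyIntegrable (fun w : ℝ × ℝ³ => (multiplierHeatPotential 1 (derivSymbol (bv i)) (D2 i) w).re) volume :=
    fun i => locallyIntegrable_re_multiplierHeatPotential (hD2i i) (hD2s i) _
  have lP4 : ∀ i, LocallyIntegrable (fun w : ℝ × ℝ³ => (multiplierHeatPotential 1 (derivSymbol (bv i)) (D4 i) w).re) volume :=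
    fun i => locallyIntegrable_re_multiplierHeatPotential (hD4i i) (hD4s i) _
  have lP6 : LocallyIntegrable (fun w : ℝ × ℝ³ => (multiplierHeatPotential 1 (derivSymbol c) D6 w).re) volume :=
    locallyIntegrable_re_multiplierHeatPotential hD6i hD6s _
  have lQ2 : ∀ i, LocallyIntegrable (fun w : ℝ × ℝ³ => heatPotential 1 (D2 i) w) volume := fun i =>
    locallyIntegrable_heatPotential (hD2i i) (hD2s i)
  have lQ4 : ∀ i, LocallyIntegrable (fun w : ℝ × ℝ³ => heatPotential 1 (D4 i) w) volume := fun i =>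
    locallyIntegrable_heatPotential (hD4i i) (hD4s i)
  have lQ6 : LocallyIntegrable (fun w : ℝ × ℝ³ => heatPotential 1 D6 w) volume := locallyIntegrable_heatPotential hD6i hD6s
  -- the terms of the space–time identity
  obtain ⟨h, hh⟩ : ∃ h : Fin 3 ⊕ Bool → ℝ × ℝ³ → ℝ, h = Sum.elim
    (fun i w => -(heatPotential 1 (D2 i) w + heatPotential 1 (D4 i) w))
    (fun bb w => if bb then -heatPotential 1 D6 w else L w - A w) := ⟨_, rfl⟩
  obtain ⟨ds, hds⟩ : ∃ ds : Fin 3 ⊕ Bool → List ℝ³, ds = Sum.elim (fun i => [bv i]) (fun bb => if bb then [c] else []) :=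
    ⟨_, rfl⟩
  have hhl : ∀ m, LocallyIntegrableOn (h m) (Ioo 0 T ×ˢ ((⊤ : Opens ℝ³) : Set ℝ³)) volume := by
    intro m
    rcases m with i | bb
    · have l : LocallyIntegrable (fun w : ℝ × ℝ³ => -(heatPotential 1 (D2 i) w + heatPotential 1 (D4 i) w)) volume :=
        ((lQ2 i).add (lQ4 i)).neg
      simp only [hh, Sum.elim_inl]
      exact l.locallyIntegrableOn _
    · cases bb
      · have l : LocallyIntegrable (fun w : ℝ × ℝ³ => L w - A w) volume := hL.sub hA
        simp only [hh, Sum.elim_inr, Bool.false_eq_true, if_false]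
        exact l.locallyIntegrableOn _
      · have l : LocallyIntegrable (fun w : ℝ × ℝ³ => -heatPotential 1 D6 w) volume := lQ6.neg
        simp only [hh, Sum.elim_inr, if_true]
        exact l.locallyIntegrableOn _
  have hdsl : ∀ m, (ds m).length ≤ 2 := by
    intro m; rcases m with i | bb
    · simp [hds]
    · cases bb <;> simp [hds]
  -- the weak-gradient identity, in the orientation used below
  have WG : ∀ {D : ℝ × ℝ³ → ℝ}, Integrable D volume → (∀ᵐ z ∂(volume : Measure (ℝ × ℝ³)), D z ≠ 0 → z.1 ∈ Icc a b) →
      ∀ {ψ : ℝ → ℝ³ → ℝ}, IsSpaceTimeTestOn (⊤ : Opens (ℝ × ℝ³)) ψ → ∀ v : ℝ³,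
      ∫ q : ℝ × ℝ³, (-(multiplierHeatPotential 1 (derivSymbol v) D q).re) * ψ q.1 q.2 =
        ∫ q : ℝ × ℝ³, heatPotential 1 D q * fderiv ℝ (ψ q.1) q.2 v := by
    intro D hDi hDs ψ hψ v
    have hwg := integral_test_mul_re_multiplierHeatPotential hDi hDs hψ v
    calc ∫ q : ℝ × ℝ³, (-(multiplierHeatPotential 1 (derivSymbol v) D q).re) * ψ q.1 q.2
        = -∫ w : ℝ × ℝ³, ψ w.1 w.2 * (multiplierHeatPotential 1 (derivSymbol v) D w).re := by
          rw [← integral_neg]; exact integral_congr_ae (Eventually.of_forall fun q => by ring)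
      _ = ∫ w : ℝ × ℝ³, fderiv ℝ (ψ w.1) w.2 v * heatPotential 1 D w := by rw [hwg, neg_neg]
      _ = _ := integral_congr_ae (Eventually.of_forall fun q => mul_comm _ _)
  -- the space–time identity against a test function on the strip
  have hid : ∀ ψ : ℝ → ℝ³ → ℝ,
      IsSpaceTimeTestOn (⟨Ioo 0 T ×ˢ ((⊤ : Opens ℝ³) : Set ℝ³), isOpen_Ioo.prod (⊤ : Opens ℝ³).isOpen⟩ :
        Opens (ℝ × ℝ³)) ψ →
        ∑ m, ∫ q : ℝ × ℝ³, h m q * RepDeriv.derivs (ds m) ψ q.1 q.2 = 0 := by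
    intro ψ hψ
    have hψ' : IsSpaceTimeTestOn (⊤ : Opens (ℝ × ℝ³)) ψ :=
      ⟨hψ.contDiff, hψ.hasCompactSupport, fun _ _ => trivial⟩
    have hψi : ∀ v : ℝ³, IsSpaceTimeTestOn (⊤ : Opens (ℝ × ℝ³)) (fun t x => fderiv ℝ (ψ t) x v) := fun v =>
      hψ'.fderiv_apply_top v
    -- integrate the a.e. identity against `ψ`
    have i2 : ∀ i, Integrable (fun q : ℝ × ℝ³ =>
        (-(multiplierHeatPotential 1 (derivSymbol (bv i)) (D2 i) q).re) * ψ q.1 q.2) volume := fun i =>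
      integrable_test_mul_of_locallyIntegrable (lP2 i).neg hψ'
    have i4 : ∀ i, Integrable (fun q : ℝ × ℝ³ =>
        (-(multiplierHeatPotential 1 (derivSymbol (bv i)) (D4 i) q).re) * ψ q.1 q.2) volume := fun i =>
      integrable_test_mul_of_locallyIntegrable (lP4 i).neg hψ'
    have i6 : Integrable (fun q : ℝ × ℝ³ =>
        (-(multiplierHeatPotential 1 (derivSymbol c) D6 q).re) * ψ q.1 q.2) volume :=
      integrable_test_mul_of_locallyIntegrable lP6.neg hψ'
    have iS2 : Integrable (fun q : ℝ × ℝ³ =>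
        ∑ i, (-(multiplierHeatPotential 1 (derivSymbol (bv i)) (D2 i) q).re) * ψ q.1 q.2) volume :=
      integrable_finsetSum _ fun i _ => i2 i
    have iS4 : Integrable (fun q : ℝ × ℝ³ =>
        ∑ i, (-(multiplierHeatPotential 1 (derivSymbol (bv i)) (D4 i) q).re) * ψ q.1 q.2) volume :=
      integrable_finsetSum _ fun i _ => i4 i
    have iS24 : Integrable (fun q : ℝ × ℝ³ =>
        ∑ i, (-(multiplierHeatPotential 1 (derivSymbol (bv i)) (D2 i) q).re) * ψ q.1 q.2 +
        ∑ i, (-(multiplierHeatPotential 1 (derivSymbol (bv i)) (D4 i) q).re) * ψ q.1 q.2) volume := iS2.add iS4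
    have hint : ∫ q : ℝ × ℝ³, (L q - A q) * ψ q.1 q.2 =
        (∑ i, ∫ q : ℝ × ℝ³, (-(multiplierHeatPotential 1 (derivSymbol (bv i)) (D2 i) q).re) * ψ q.1 q.2) +
        (∑ i, ∫ q : ℝ × ℝ³, (-(multiplierHeatPotential 1 (derivSymbol (bv i)) (D4 i) q).re) * ψ q.1 q.2) +
          ∫ q : ℝ × ℝ³, (-(multiplierHeatPotential 1 (derivSymbol c) D6 q).re) * ψ q.1 q.2 := by
      have hae : (fun q : ℝ × ℝ³ => (L q - A q) * ψ q.1 q.2) =ᵐ[volume]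
          fun q => (∑ i, (-(multiplierHeatPotential 1 (derivSymbol (bv i)) (D2 i) q).re) * ψ q.1 q.2 +
            ∑ i, (-(multiplierHeatPotential 1 (derivSymbol (bv i)) (D4 i) q).re) * ψ q.1 q.2) +
            (-(multiplierHeatPotential 1 (derivSymbol c) D6 q).re) * ψ q.1 q.2 := by
        have hrep' := (ae_restrict_iff' (measurableSet_Ioo.prod MeasurableSet.univ)).1 hrep
        filter_upwards [hrep'] with q hq
        by_cases hqS : q ∈ Ioo 0 T ×ˢ (univ : Set ℝ³)
        · have e := hq hqS
          have e' : L q - A q = ∑ i, (-(multiplierHeatPotential 1 (derivSymbol (bv i)) (D2 i) q).re)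
              + ∑ i, (-(multiplierHeatPotential 1 (derivSymbol (bv i)) (D4 i) q).re)
              + (-(multiplierHeatPotential 1 (derivSymbol c) D6 q).re) := by rw [e]; ring
          rw [e', add_mul, add_mul, Finset.sum_mul, Finset.sum_mul]
        · have hψ0 : ψ q.1 q.2 = 0 := by
            have hq' : q ∉ tsupport (uncurry ψ) := fun h' => hqS (hψ.tsupport_subset h')
            have := image_eq_zero_of_notMem_tsupport hq'
            simpa [uncurry] using this
          simp only [hψ0, mul_zero, Finset.sum_const_zero, add_zero]
      rw [integral_congr_ae hae, integral_add iS24 i6, integral_add iS2 iS4,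
        integral_finsetSum _ fun i _ => i2 i, integral_finsetSum _ fun i _ => i4 i]
    simp_rw [WG (hD2i _) (hD2s _) hψ', WG (hD4i _) (hD4s _) hψ', WG hD6i hD6s hψ'] at hint
    -- assemble `∑ m`
    rw [Fintype.sum_sum_type, Fintype.sum_bool]
    simp only [hh, hds, Sum.elim_inl, Sum.elim_inr, if_true, if_false, Bool.false_eq_true,
      RepDeriv.derivs_nil, RepDeriv.derivs_singleton]
    have iQ2 : ∀ i, Integrable (fun q : ℝ × ℝ³ => heatPotential 1 (D2 i) q * fderiv ℝ (ψ q.1) q.2 (bv i)) volume := fun i =>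
      integrable_test_mul_of_locallyIntegrable (lQ2 i) (hψi _)
    have iQ4 : ∀ i, Integrable (fun q : ℝ × ℝ³ => heatPotential 1 (D4 i) q * fderiv ℝ (ψ q.1) q.2 (bv i)) volume := fun i =>
      integrable_test_mul_of_locallyIntegrable (lQ4 i) (hψi _)
    have e2 : ∀ i, ∫ q : ℝ × ℝ³, -(heatPotential 1 (D2 i) q + heatPotential 1 (D4 i) q) * fderiv ℝ (ψ q.1) q.2 (bv i) =
        -((∫ q : ℝ × ℝ³, heatPotential 1 (D2 i) q * fderiv ℝ (ψ q.1) q.2 (bv i)) +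
          ∫ q : ℝ × ℝ³, heatPotential 1 (D4 i) q * fderiv ℝ (ψ q.1) q.2 (bv i)) := by
      intro i
      rw [← integral_add (iQ2 i) (iQ4 i), ← integral_neg]
      exact integral_congr_ae (Eventually.of_forall fun q => by ring)
    have e6 : ∫ q : ℝ × ℝ³, -heatPotential 1 D6 q * fderiv ℝ (ψ q.1) q.2 c =
        -∫ q : ℝ × ℝ³, heatPotential 1 D6 q * fderiv ℝ (ψ q.1) q.2 c := by
      rw [← integral_neg]; exact integral_congr_ae (Eventually.of_forall fun q => by ring)
    simp_rw [e2]
    rw [e6, Finset.sum_neg_distrib, Finset.sum_add_distrib, hint]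
    ring
  have hsl := RepDeriv.ae_slice_identity_sum hhl hdsl hid
  filter_upwards [hsl] with t ht φ hφ
  have h0 := ht φ hφ
  rw [Fintype.sum_sum_type, Fintype.sum_bool] at h0
  simp only [hh, hds, Sum.elim_inl, Sum.elim_inr, if_true, if_false, Bool.false_eq_true,
    RepDeriv.sderivs_nil, RepDeriv.sderivs_cons] at h0
  -- read off the sliced identity
  simp_rw [neg_mul, integral_neg, Finset.sum_neg_distrib] at h0
  linarith

end HeatPotentialSlice

end Literature.Analysis.FluidPDE
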